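import Literature.Barriers.CriticalPhenomena.WeaklySAWPerturbativeBetaLimit
import Literature.Barriers.CriticalPhenomena.FiniteRangeDecompositionMassLipschitz
import Literature.Barriers.CriticalPhenomena.WeaklySAWPerturbativeBetaMassDecay
import HarnessLib

/-!
# BBS-rg-pt, Lemma 6.3.1 for the weakly self-avoiding walk (`d = 4`): `β_j(m²)` is insensitive to
# the mass below the mass scale, `|β_j(m²) - β_j(0)| ≤ K_L(L^{-j} + m²L^{2j})`, hence `β_j(m²) ≥ c`
# for `n ≤ j ≤ j_m - n`

Companion of `WeaklySAWPerturbativeBetaLimit.lean` (`β_j(0) → β̄_L > 0`: the critical half of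
Assumption (A1) of Bauerschmidt–Brydges–Slade, CMP 337 (2015) [BBS2015], §6.1) and of
`FiniteRangeDecompositionMassLipschitz.lean` (`|Γ_{j+1}(x;s) - Γ_{j+1}(x;0)| ≤ C_L(L^{-3(j+1)} + s)` at
`d = 4`). Source for this layer: R. Bauerschmidt, D. C. Brydges, G. Slade, *A renormalisation group
method. III. Perturbative analysis*, J. Stat. Phys. **159** (2015), arXiv:1403.7252 [BBS-rg-pt] —
the paper to which [BBS2015] §6.1 defers for Assumption (A1) ("it is shown in [BBS-rg-pt] that …
the following two assumptions are satisfied") — §6.3: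

"**Lemma 6.3.1.** Let `d = 4`, `m̄² > 0`, and `m² ∈ [0,m̄²]`. For any `c < π⁻²log L`, there exists
`n < ∞` such that `β_j(m²) ≥ c` for `n ≤ j ≤ j_m - n`, uniformly in `m² ∈ [0,m̄²]`.
*Proof.* Let `ε > 0` satisfy `c + ε < π⁻²log L`. By (delw2lim), there exists `n₀` such that
`β_j(0) ≥ c + ε` if `j ≥ n₀`. This is sufficient for the case `m² = 0`, where `j_m - n = ∞`. Thus we
consider `m² > 0`. … By definition in (jmdef), `j_m = ⌊log_{L²}m⁻²⌋`, so `m²L^{2j_m} ≤ 1`. Thus …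
if `1 < j ≤ j_m - n₁` then `|β_j(0) - β_j(m²)| ≤ c'(log L)L^{4+2j}m² ≤ c'(log L)L^{4-2n₁} ≤ ε`.
Therefore, `β_j(m²) ≥ c` if `n₀ ≤ j ≤ j_m - n₁`, as claimed."

## What this file proves (everything; no definition, no named fact)

For the explicit sequence `β_j(m²) = CTWSAW.betaPT 4 L m² j` (BBS2015 §6.1) with `m² = s ∈ [0,1]`
(`m̄² = 1`) and `L ≥ 2`:

* `abs_Gam_four_mass_sub_le` — `|Γ_{i+1}(x;s) - Γ_{i+1}(x;0)| ≤ (D/L^{3i} + Cs)·𝟙{|x|₁ < ½L^{i+1}}`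
  for all `i ≥ 0` (the `d = 4` reading of `FRD.abs_Gam_mass_sub_le`, `i = 0` by the scaling bound);
* `abs_covSum_four_mass_sub_le` — the same summed: `|w_j(x;s) - w_j(x;0)| ≤ Σ_{i<j}(D/L^{3i} + Cs)𝟙_i(x)`;
* **`abs_betaPT_mass_sub_le`** — `|β_j(s) - β_j(0)| ≤ K(L^{-j} + sL^{2j})` for all `s ∈ [0,1]`,
  `j ≥ 0` (`K = K(L)`): the printed `|β_j(0) - β_j(m²)| ≤ c'(log L)L^{4+2j}m²` up to the harmless
  `L^{-j}` (the self-similarity road to mass-insensitivity; it only raises the `n` of the lemma);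
* **`BBSrgpt_lem631`** — Lemma 6.3.1 for the explicit `β`: for every `c < β̄_L` (`= betaLim L`, the
  limit of `β_j(0)` of `WeaklySAWPerturbativeBetaLimit.lean`, the tree's name for the source's
  `π⁻²log L`) there is `n` with `β_j(s) ≥ c` whenever `n ≤ j` and `sL^{2(j+n)} ≤ 1` (i.e.
  `j ≤ j_m - n`, `j_m = ⌊log_{L²}s⁻¹⌋`; vacuous restriction at `s = 0`), uniformly in `s ∈ [0,1]`.
-/

noncomputable section

open Set Filter Topology
open Literature.Probability.LatticeModels
open scoped BigOperators

namespace Literature.Barriers.CriticalPhenomena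

namespace CTWSAW

open LongRangePhi4 LongRangePhi4.FRD

/-! ### Mass-insensitivity of `Γ_{i+1}` and of `w_j` at `d = 4` -/

/-- **`|Γ_{i+1}(x;s) - Γ_{i+1}(x;0)| ≤ (D/L^{3i} + Cs)𝟙{|x|₁ < ½L^{i+1}}`** for all `i ≥ 0`, `s ∈ [0,1]`
(`d = 4`, `L ≥ 2`): `FRD.abs_Gam_mass_sub_le` for `i ≥ 1` (`Λ/Λ⁴ = L^{-3(i+1)}`, `(Λ²/Λ⁴)sΛ² = s`),
the scaling bound `|Γ_1| ≤ c` for `i = 0`, and finite range outside the ball.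
[cite: BauerschmidtBrydgesSlade2015LogCorr, §5.1–§5.2 (finite range and scaling estimates) and §6.1] -/
theorem abs_Gam_four_mass_sub_le {L : ℝ} (hL : 2 ≤ L) :
    ∃ D C : ℝ, 0 < D ∧ 0 < C ∧ ∀ s : ℝ, 0 ≤ s → s ≤ 1 → ∀ i : ℕ, ∀ x : Site 4,
      |Gam 4 L s (i + 1) x - Gam 4 L 0 (i + 1) x| ≤
        (D / L ^ (3 * i) + C * s) * (if x ∈ PT.ball (L ^ (i + 1) / 2) then (1 : ℝ) else 0) := by
  obtain ⟨c, hc, hG⟩ := abs_Gam_four_le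
  obtain ⟨C, hC, hM⟩ := abs_Gam_mass_sub_le (d := 4) (by norm_num) hL
  have hL0 : (0 : ℝ) < L := by linarith
  have hL1 : (1 : ℝ) ≤ L := by linarith
  refine ⟨2 * c + C, C, by positivity, hC, fun s hs hs1 i x => ?_⟩
  split_ifs with hx
  · rw [mul_one]
    rcases Nat.eq_zero_or_pos i with hi | hi
    · subst hi
      have h1 := hG L hL s hs 0 x
      have h0 := hG L hL 0 le_rfl 0 x
      simp only [mul_zero, pow_zero, div_one] at h1 h0 ⊢
      calc |Gam 4 L s 1 x - Gam 4 L 0 1 x| ≤ |Gam 4 L s 1 x| + |Gam 4 L 0 1 x| := abs_sub _ _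
        _ ≤ c + c := add_le_add h1 h0
        _ ≤ 2 * c + C + C * s := by nlinarith
    · have h := hM s hs hs1 i hi x
      have hΛ : (0 : ℝ) < L ^ (i + 1) := pow_pos hL0 _
      have e1 : L ^ (i + 1) / (L ^ (i + 1)) ^ 4 = 1 / (L ^ (i + 1)) ^ 3 := by
        field_simp
      have e2 : (L ^ (i + 1)) ^ 2 / (L ^ (i + 1)) ^ 4 * (s * (L ^ (i + 1)) ^ 2) = s := by
        field_simp
      rw [e1, e2] at h
      refine h.trans ?_
      have h3 : C * (1 / (L ^ (i + 1)) ^ 3) ≤ (2 * c + C) / L ^ (3 * i) := by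
        rw [← pow_mul, show (i + 1) * 3 = 3 * i + 3 by ring, pow_add, mul_one_div,
          div_le_div_iff₀ (by positivity) (by positivity)]
        have hL3 : (1 : ℝ) ≤ L ^ 3 := one_le_pow₀ hL1
        have hp : (0 : ℝ) < L ^ (3 * i) := pow_pos hL0 _
        calc C * L ^ (3 * i) ≤ C * (L ^ (3 * i) * L ^ 3) :=
              mul_le_mul_of_nonneg_left (le_mul_of_one_le_right hp.le hL3) hC.le
          _ ≤ (2 * c + C) * (L ^ (3 * i) * L ^ 3) :=
              mul_le_mul_of_nonneg_right (by linarith) (by positivity)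
      nlinarith
  · rw [mul_zero]
    rw [PT.mem_ball, not_lt] at hx
    rw [Gam_eq_zero (by norm_num) hL0.le hs (i + 1) x hx,
      Gam_eq_zero (by norm_num) hL0.le le_rfl (i + 1) x hx, sub_zero, abs_zero]

/-- **`|w_j(x;s) - w_j(x;0)| ≤ Σ_{i<j}(D/L^{3i} + Cs)𝟙{|x|₁ < ½L^{i+1}}`**.
[cite: BauerschmidtBrydgesSlade2015LogCorr, §6.1 (w_j = Σ_{i≤j}C_i)] -/
theorem abs_covSum_four_mass_sub_le {L D C : ℝ}
    (h : ∀ s : ℝ, 0 ≤ s → s ≤ 1 → ∀ i : ℕ, ∀ x : Site 4,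
      |Gam 4 L s (i + 1) x - Gam 4 L 0 (i + 1) x| ≤
        (D / L ^ (3 * i) + C * s) * (if x ∈ PT.ball (L ^ (i + 1) / 2) then (1 : ℝ) else 0))
    {s : ℝ} (hs : 0 ≤ s) (hs1 : s ≤ 1) (j : ℕ) (x : Site 4) :
    |covSum 4 L s j x - covSum 4 L 0 j x| ≤ ∑ i ∈ Finset.range j,
      (D / L ^ (3 * i) + C * s) * (if x ∈ PT.ball (L ^ (i + 1) / 2) then (1 : ℝ) else 0) := by
  unfold covSum
  rw [← Finset.sum_sub_distrib]
  exact (Finset.abs_sum_le_sum_abs _ _).trans (Finset.sum_le_sum fun i _ => h s hs hs1 i x)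

/-! ### Mass-insensitivity of `β_j` -/

/-- **`|β_j(s) - β_j(0)| ≤ K(L^{-j} + sL^{2j})`** for all `s ∈ [0,1]`, `j ≥ 0` (`d = 4`, `L ≥ 2`,
`K = K(L)`): with `w_{j+1}² - w_j² = 2w_jC_{j+1} + C_{j+1}²`,
`Δ = 2(w_j-w_j⁰)C_{j+1} + 2w_j⁰(C_{j+1}-C_{j+1}⁰) + (C_{j+1}-C_{j+1}⁰)(C_{j+1}+C_{j+1}⁰)`, and the sums
over `x` are controlled support-sensitively (`Σ_x𝟙_i ≤ 16L⁴L^{4i}`) by `Σ_{i<j}Lⁱ ≤ Lʲ`,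
`Σ_{i<j}L^{2i} ≤ 2L^{2j}`, `Σ_{i<j}L^{4i} ≤ L^{4j}`.
[cite: BauerschmidtBrydgesSlade2015LogCorr, §6.1 (β_j and "these coefficients depend continuously on m²", deferred to [BBS-rg-pt], Lemma 6.1.3(b)/Lemma 6.3.1)] -/
theorem abs_betaPT_mass_sub_le {L : ℝ} (hL : 2 ≤ L) :
    ∃ K : ℝ, 0 < K ∧ ∀ s : ℝ, 0 ≤ s → s ≤ 1 → ∀ j : ℕ,
      |betaPT 4 L s j - betaPT 4 L 0 j| ≤ K * (1 / L ^ j + s * L ^ (2 * j)) := by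
  obtain ⟨c, hc, hG⟩ := abs_Gam_four_le
  obtain ⟨D, C, hD, hC, hM⟩ := abs_Gam_four_mass_sub_le hL
  refine ⟨1024 * c * L ^ 4 * (D + C), by positivity, fun s hs hs1 j => ?_⟩
  classical
  have hL1 : (1 : ℝ) ≤ L := by linarith
  have hL0 : (0 : ℝ) < L := by linarith
  -- abbreviations
  set a : ℕ → ℝ := fun i => c / L ^ (2 * i) with ha
  set δ : ℕ → ℝ := fun i => D / L ^ (3 * i) + C * s with hδ
  set ind : ℕ → Site 4 → ℝ := fun i x => if x ∈ PT.ball (L ^ (i + 1) / 2) then (1 : ℝ) else 0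
    with hind
  set S : Finset (Site 4) := PT.ball (L ^ (j + 1) / 2) with hSdef
  have ha0 : ∀ i, 0 ≤ a i := fun i => by simp only [ha]; positivity
  have hδ0 : ∀ i, 0 ≤ δ i := fun i => by simp only [hδ]; positivity
  have hind0 : ∀ i x, 0 ≤ ind i x := fun i x => by
    simp only [hind]; split_ifs <;> norm_num
  have hind1 : ∀ i x, ind i x ≤ 1 := fun i x => by
    simp only [hind]; split_ifs <;> norm_num
  -- pointwise bounds
  have hGs : ∀ x, |Gam 4 L s (j + 1) x| ≤ a j := fun x => hG L hL s hs j x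
  have hG0 : ∀ x, |Gam 4 L 0 (j + 1) x| ≤ a j := fun x => hG L hL 0 le_rfl j x
  have hGd : ∀ x, |Gam 4 L s (j + 1) x - Gam 4 L 0 (j + 1) x| ≤ δ j := fun x =>
    (hM s hs hs1 j x).trans (mul_le_of_le_one_right (hδ0 j) (hind1 j x))
  have hW0 : ∀ x, |covSum 4 L 0 j x| ≤ ∑ i ∈ Finset.range j, a i * ind i x := fun x =>
    abs_covSum_four_le hG hL le_rfl j x
  have hWd : ∀ x, |covSum 4 L s j x - covSum 4 L 0 j x| ≤ ∑ i ∈ Finset.range j, δ i * ind i x :=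
    fun x => abs_covSum_four_mass_sub_le hM hs hs1 j x
  have hpt : ∀ x, |(covSum 4 L s (j + 1) x ^ 2 - covSum 4 L s j x ^ 2) -
      (covSum 4 L 0 (j + 1) x ^ 2 - covSum 4 L 0 j x ^ 2)| ≤
      2 * a j * ∑ i ∈ Finset.range j, δ i * ind i x +
        2 * δ j * ∑ i ∈ Finset.range j, a i * ind i x + δ j * (2 * a j) := by
    intro x
    rw [covSum_succ, covSum_succ]
    set G := Gam 4 L s (j + 1) x
    set G0 := Gam 4 L 0 (j + 1) x
    set W := covSum 4 L s j x
    set W0 := covSum 4 L 0 j x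
    have e : ((W + G) ^ 2 - W ^ 2) - ((W0 + G0) ^ 2 - W0 ^ 2) =
        2 * ((W - W0) * G) + 2 * (W0 * (G - G0)) + (G - G0) * (G + G0) := by ring
    rw [e]
    refine (abs_add_le _ _).trans (add_le_add ((abs_add_le _ _).trans (add_le_add ?_ ?_)) ?_)
    · rw [abs_mul, abs_two, abs_mul, mul_assoc]
      refine mul_le_mul_of_nonneg_left ?_ (by norm_num)
      rw [mul_comm]
      exact mul_le_mul (hGs x) (hWd x) (abs_nonneg _) (ha0 j)
    · rw [abs_mul, abs_two, abs_mul, mul_assoc]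
      refine mul_le_mul_of_nonneg_left ?_ (by norm_num)
      rw [mul_comm]
      exact mul_le_mul (hGd x) (hW0 x) (abs_nonneg _) (hδ0 j)
    · rw [abs_mul]
      refine mul_le_mul (hGd x) ((abs_add_le _ _).trans ?_) (abs_nonneg _) (hδ0 j)
      linarith [hGs x, hG0 x]
  -- sums of indicators over `S`
  have hI : ∀ i, ∑ x ∈ S, ind i x ≤ 16 * L ^ 4 * L ^ (4 * i) := fun i => sum_ball_indicator_le _ hL1 i
  have hcard : (S.card : ℝ) ≤ 16 * L ^ 4 * L ^ (4 * j) := card_ball_four_le hL1 j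
  -- the `δ`-weighted indicator sum: `Σ_i δ_i Σ_x 𝟙_i ≤ 16L⁴(DLʲ + CsL^{4j})`
  have e4 : ∀ i : ℕ, L ^ (4 * i) / L ^ (3 * i) = L ^ i := fun i => by
    rw [div_eq_iff (pow_ne_zero _ hL0.ne'), ← pow_add]
    ring_nf
  have hSδ : ∑ x ∈ S, ∑ i ∈ Finset.range j, δ i * ind i x ≤ 16 * L ^ 4 * (D * L ^ j + C * s * L ^ (4 * j)) := by
    rw [Finset.sum_comm]
    have h1 : ∀ i ∈ Finset.range j, ∑ x ∈ S, δ i * ind i x ≤ 16 * L ^ 4 * (D * L ^ i + C * s * L ^ (4 * i)) := by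
      intro i _
      rw [← Finset.mul_sum]
      calc δ i * ∑ x ∈ S, ind i x ≤ δ i * (16 * L ^ 4 * L ^ (4 * i)) :=
            mul_le_mul_of_nonneg_left (hI i) (hδ0 i)
        _ = 16 * L ^ 4 * (D * (L ^ (4 * i) / L ^ (3 * i)) + C * s * L ^ (4 * i)) := by
            simp only [hδ]; ring
        _ = 16 * L ^ 4 * (D * L ^ i + C * s * L ^ (4 * i)) := by rw [e4 i]
    refine (Finset.sum_le_sum h1).trans ?_
    rw [← Finset.mul_sum, Finset.sum_add_distrib, ← Finset.mul_sum, ← Finset.mul_sum]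
    have hg1 := geom_sum_le_pow hL j
    have hg4 := geom_sum_four_le_pow hL j
    have k0 : 0 ≤ 16 * L ^ 4 := by positivity
    refine mul_le_mul_of_nonneg_left ?_ k0
    have : 0 ≤ C * s := by positivity
    nlinarith [mul_le_mul_of_nonneg_left hg4 this, mul_le_mul_of_nonneg_left hg1 hD.le]
  -- the `a`-weighted indicator sum: `Σ_i a_i Σ_x 𝟙_i ≤ 32cL⁴L^{2j}`
  have hSa : ∑ x ∈ S, ∑ i ∈ Finset.range j, a i * ind i x ≤ 32 * c * L ^ 4 * L ^ (2 * j) := by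
    rw [Finset.sum_comm]
    have hai : ∀ i, a i * (16 * L ^ 4 * L ^ (4 * i)) = 16 * c * L ^ 4 * L ^ (2 * i) := by
      intro i
      simp only [ha]
      have : L ^ (4 * i) = L ^ (2 * i) * L ^ (2 * i) := by rw [← pow_add]; ring_nf
      rw [this]
      field_simp
    have h1 : ∀ i ∈ Finset.range j, ∑ x ∈ S, a i * ind i x ≤ 16 * c * L ^ 4 * L ^ (2 * i) := by
      intro i _
      rw [← Finset.mul_sum, ← hai i]
      exact mul_le_mul_of_nonneg_left (hI i) (ha0 i)
    refine (Finset.sum_le_sum h1).trans ?_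
    rw [← Finset.mul_sum]
    have := geom_sum_sq_le hL j
    have k0 : 0 ≤ 16 * c * L ^ 4 := by positivity
    nlinarith [mul_le_mul_of_nonneg_left this k0]
  -- identities for `a_j`
  have haj1 : a j * L ^ j = c / L ^ j := by
    simp only [ha]
    rw [show 2 * j = j + j by ring, pow_add]
    field_simp
  have haj2 : a j * L ^ (4 * j) = c * L ^ (2 * j) := by
    simp only [ha]
    rw [show 4 * j = 2 * j + 2 * j by ring, pow_add]
    field_simp
  have haj3 : a j * L ^ (2 * j) = c := by
    simp only [ha]; field_simp
  -- `δ_j L^{2j} ≤ D/Lʲ + CsL^{2j}` and `δ_j ≤ D/Lʲ·… `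
  have hδj : δ j * L ^ (2 * j) ≤ D * (1 / L ^ j) + C * s * L ^ (2 * j) := by
    simp only [hδ]
    rw [add_mul]
    refine add_le_add (le_of_eq ?_) le_rfl
    rw [show 3 * j = j + 2 * j by ring, pow_add]
    field_simp
  -- assemble the sum over `S`
  have htot : ∑ x ∈ S, |(covSum 4 L s (j + 1) x ^ 2 - covSum 4 L s j x ^ 2) -
      (covSum 4 L 0 (j + 1) x ^ 2 - covSum 4 L 0 j x ^ 2)| ≤
      128 * c * L ^ 4 * (D * (1 / L ^ j) + C * s * L ^ (2 * j)) := by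
    refine (Finset.sum_le_sum fun x _ => hpt x).trans ?_
    rw [Finset.sum_add_distrib, Finset.sum_add_distrib, ← Finset.mul_sum, ← Finset.mul_sum,
      Finset.sum_const, nsmul_eq_mul]
    -- Term 1
    have hT1 : 2 * a j * ∑ x ∈ S, ∑ i ∈ Finset.range j, δ i * ind i x ≤
        32 * c * L ^ 4 * (D * (1 / L ^ j) + C * s * L ^ (2 * j)) := by
      calc 2 * a j * ∑ x ∈ S, ∑ i ∈ Finset.range j, δ i * ind i x
          ≤ 2 * a j * (16 * L ^ 4 * (D * L ^ j + C * s * L ^ (4 * j))) :=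
            mul_le_mul_of_nonneg_left hSδ (by positivity)
        _ = 32 * L ^ 4 * (D * (a j * L ^ j) + C * s * (a j * L ^ (4 * j))) := by ring
        _ = 32 * c * L ^ 4 * (D * (1 / L ^ j) + C * s * L ^ (2 * j)) := by
            rw [haj1, haj2]; ring
    -- Term 2
    have hT2 : 2 * δ j * ∑ x ∈ S, ∑ i ∈ Finset.range j, a i * ind i x ≤
        64 * c * L ^ 4 * (D * (1 / L ^ j) + C * s * L ^ (2 * j)) := by
      calc 2 * δ j * ∑ x ∈ S, ∑ i ∈ Finset.range j, a i * ind i x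
          ≤ 2 * δ j * (32 * c * L ^ 4 * L ^ (2 * j)) :=
            mul_le_mul_of_nonneg_left hSa (by positivity)
        _ = 64 * c * L ^ 4 * (δ j * L ^ (2 * j)) := by ring
        _ ≤ 64 * c * L ^ 4 * (D * (1 / L ^ j) + C * s * L ^ (2 * j)) :=
            mul_le_mul_of_nonneg_left hδj (by positivity)
    -- Term 3
    have hT3 : (S.card : ℝ) * (δ j * (2 * a j)) ≤
        32 * c * L ^ 4 * (D * (1 / L ^ j) + C * s * L ^ (2 * j)) := by
      calc (S.card : ℝ) * (δ j * (2 * a j)) ≤ 16 * L ^ 4 * L ^ (4 * j) * (δ j * (2 * a j)) :=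
            mul_le_mul_of_nonneg_right hcard (by positivity)
        _ = 32 * L ^ 4 * (a j * L ^ (2 * j)) * (δ j * L ^ (2 * j)) := by ring
        _ = 32 * c * L ^ 4 * (δ j * L ^ (2 * j)) := by rw [haj3]; ring
        _ ≤ 32 * c * L ^ 4 * (D * (1 / L ^ j) + C * s * L ^ (2 * j)) :=
            mul_le_mul_of_nonneg_left hδj (by positivity)
    linarith
  -- conclude
  rw [betaPT_eq_sum (by norm_num) hL1 hs j, betaPT_eq_sum (by norm_num) hL1 le_rfl j, ← mul_sub,
    ← Finset.sum_sub_distrib, abs_mul, show |(8 : ℝ)| = 8 by norm_num]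
  have hfin : D * (1 / L ^ j) + C * s * L ^ (2 * j) ≤ (D + C) * (1 / L ^ j + s * L ^ (2 * j)) := by
    have h1 : 0 ≤ 1 / L ^ j := by positivity
    have h2 : 0 ≤ s * L ^ (2 * j) := by positivity
    nlinarith
  calc 8 * |∑ x ∈ S, ((covSum 4 L s (j + 1) x ^ 2 - covSum 4 L s j x ^ 2) -
        (covSum 4 L 0 (j + 1) x ^ 2 - covSum 4 L 0 j x ^ 2))|
      ≤ 8 * (128 * c * L ^ 4 * (D * (1 / L ^ j) + C * s * L ^ (2 * j))) :=
        mul_le_mul_of_nonneg_left ((Finset.abs_sum_le_sum_abs _ _).trans htot) (by norm_num)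
    _ = 1024 * c * L ^ 4 * (D * (1 / L ^ j) + C * s * L ^ (2 * j)) := by ring
    _ ≤ 1024 * c * L ^ 4 * ((D + C) * (1 / L ^ j + s * L ^ (2 * j))) :=
        mul_le_mul_of_nonneg_left hfin (by positivity)
    _ = 1024 * c * L ^ 4 * (D + C) * (1 / L ^ j + s * L ^ (2 * j)) := by ring

/-! ### Lemma 6.3.1 -/

/-- **[BBS-rg-pt] Lemma 6.3.1 for the weakly self-avoiding walk, PROVED** (explicit `β_j(m²) =
betaPT 4 L m² j`, `m² = s ∈ [0,1]`, `L ≥ 2`): for every `c < β̄_L` (`β̄_L = betaLim L = lim_jβ_j(0)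
> 0`) there is `n` such that `β_j(s) ≥ c` whenever `n ≤ j` and `sL^{2(j+n)} ≤ 1` — i.e. for
`n ≤ j ≤ j_m - n` with the mass scale `j_m = ⌊log_{L²}s⁻¹⌋` (`m²L^{2j_m} ≤ 1`), and for all `j ≥ n`
at `s = 0` — uniformly in `s`. Printed proof: `β_j(0) ≥ c + ε` for `j ≥ n₀` (the massless limit),
and `|β_j(0) - β_j(s)| ≤ ε` below the mass scale (mass-insensitivity).
[cite: BauerschmidtBrydgesSlade2015LogCorr, §6.1 (Assumption (A1): "it is shown in [BBS-rg-pt] that … [it is] satisfied"; [BBS-rg-pt] = arXiv:1403.7252, Lemma 6.3.1)] -/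
theorem BBSrgpt_lem631 {L : ℝ} (hL : 2 ≤ L) {c : ℝ} (hc : c < betaLim L) :
    ∃ n : ℕ, ∀ s : ℝ, 0 ≤ s → s ≤ 1 → ∀ j : ℕ, n ≤ j → s * L ^ (2 * (j + n)) ≤ 1 →
      c ≤ betaPT 4 L s j := by
  have hL0 : (0 : ℝ) < L := by linarith
  have hL1 : (1 : ℝ) < L := by linarith
  obtain ⟨K, hK, hE⟩ := abs_betaPT_mass_sub_le hL
  set ε : ℝ := (betaLim L - c) / 2 with hε
  have hε0 : 0 < ε := by rw [hε]; linarith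
  -- `β_j(0) ≥ c + ε` for `j ≥ n₀`
  have hT := tendsto_betaPT_zero hL
  have hev : ∀ᶠ j in atTop, c + ε < betaPT 4 L 0 j :=
    hT.eventually (lt_mem_nhds (by rw [hε]; linarith))
  obtain ⟨n₀, hn₀⟩ := eventually_atTop.1 hev
  -- `K/L^{n₁} ≤ ε/2`
  have hpow : Tendsto (fun n : ℕ => K / L ^ n) atTop (𝓝 0) :=
    tendsto_const_nhds.div_atTop (tendsto_pow_atTop_atTop_of_one_lt hL1)
  obtain ⟨n₁, hn₁⟩ := eventually_atTop.1 (hpow.eventually (gt_mem_nhds (half_pos hε0)))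
  refine ⟨max n₀ n₁, fun s hs hs1 j hj hsj => ?_⟩
  have hj0 : n₀ ≤ j := le_trans (le_max_left _ _) hj
  have hj1 : n₁ ≤ j := le_trans (le_max_right _ _) hj
  have hn1 : n₁ ≤ max n₀ n₁ := le_max_right _ _
  have hβ0 := hn₀ j hj0
  have hdiff := hE s hs hs1 j
  -- `K/Lʲ < ε/2`
  have hA : K / L ^ j < ε / 2 := by
    have h1 := hn₁ j hj1
    simpa using h1
  -- `KsL^{2j} ≤ K/L^{2n} ≤ K/L^{n₁} < ε/2`
  have hB : K * (s * L ^ (2 * j)) ≤ ε / 2 := by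
    have h1 := hn₁ (max n₀ n₁) hn1
    have h2 : s * L ^ (2 * j) ≤ 1 / L ^ (max n₀ n₁) := by
      rw [le_div_iff₀ (pow_pos hL0 _)]
      have e : s * L ^ (2 * (j + max n₀ n₁)) = s * L ^ (2 * j) * L ^ max n₀ n₁ * L ^ max n₀ n₁ := by
        rw [show 2 * (j + max n₀ n₁) = 2 * j + max n₀ n₁ + max n₀ n₁ by ring, pow_add, pow_add]
        ring
      have h3 : (1 : ℝ) ≤ L ^ max n₀ n₁ := one_le_pow₀ hL1.le
      have h4 : 0 ≤ s * L ^ (2 * j) * L ^ max n₀ n₁ := by positivity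
      nlinarith
    calc K * (s * L ^ (2 * j)) ≤ K * (1 / L ^ max n₀ n₁) := mul_le_mul_of_nonneg_left h2 hK.le
      _ = K / L ^ max n₀ n₁ := by rw [mul_one_div]
      _ ≤ ε / 2 := by
          have : K / L ^ max n₀ n₁ < ε / 2 := by simpa using h1
          exact this.le
  have habs : |betaPT 4 L s j - betaPT 4 L 0 j| ≤ ε := by
    refine hdiff.trans ?_
    rw [mul_add, mul_one_div]
    linarith
  have := neg_abs_le (betaPT 4 L s j - betaPT 4 L 0 j)
  linarith

end CTWSAW

end Literature.Barriers.CriticalPhenomena
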